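import Summits.PneNP.PneNP.Theorems.SymmetryBudgetHamCompilesStubResidueNPSpec
import Summits.PneNP.PneNP.Theorems.SymmetryBudgetHamCompilesStubResidueNPCode

/-!
# `ResidueLang ∈ NP` (line `kotzig-cutspan`, stub `stub_residueNP`)

Crux `Summit.PneNP.PneNP.Theses.SymmetryBudget.HamCompiles` (stmt-PneNP-10637), route
`PneNP/SymmetryBudget`, line `kotzig-cutspan`, stub **`stub_residueNP`**: the residual language
`ResidueLang` of the line (interface strings `encode m (ab, fb)`, `m ≥ 4`, whose blocks satisfy
`Residue m ab fb`) is in `NP = polyExists P`. The verifier `ResNP.check` (an explicit functional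
program, `…StubResidueNPCheck.lean`) is computed on codes in polynomial time (`ResNP.check_code`,
`…StubResidueNPCode.lean`); here its parity test is compared with the pairing over `GF(2)`
(`parityOK_iff`: the stars-and-bars number of `List.ofFn d` is the number of `sbCode d`, the
digits of the number of a cut are its bits, `admB` / `consB` decide `Adm` / `consA`), it is proved
SOUND (`check_sound`: the string is the layout of the bits read off it, the untyped certificate
lifts to a typed one) and COMPLETE with certificates of length `≤ 200 |s|² + 200`
(`check_complete`: the untyped form of a witness `(d, PA, S₀)` of `Residue`), and the generic
assembly `ResNP.mem_NP_of_check` (`…StubResidueNPCheck.lean`) concludes.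

Reference: S. Arora, B. Barak, *Computational Complexity: A Modern Approach*, CUP 2009, Def. 2.1.
-/

-- `Summit.PneNP.PneNP.…` duplicates `PneNP` BY DESIGN (single-problem summit, D-0017).
set_option linter.dupNamespace false

noncomputable section

namespace Summit.PneNP.PneNP.Theorems.HamCompilesKC

open Literature.Computability.Complexity
open Finset CodeFP Polynomial

namespace ResNP

variable {m g : ℕ}

/-! ### The stars-and-bars number -/

/-- **Prefix sums of `List.ofFn d`.** -/
theorem psum_ofFn (d : Fin g → ℕ) (i : Fin g) :
    psum g (List.ofFn d) i = ∑ t ∈ univ.filter (fun t : Fin g => t ≤ i), d t := by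
  rw [psum, min_eq_left (by omega : (i : ℕ) + 1 ≤ g), sum_map_range]
  have hmap : (univ.filter fun t : Fin g => t ≤ i).map Fin.valEmbedding = Finset.range ((i : ℕ) + 1) := by
    ext n
    simp only [Finset.mem_map, Finset.mem_filter, Finset.mem_univ, true_and, Fin.valEmbedding_apply,
      Finset.mem_range]
    constructor
    · rintro ⟨t, ht, rfl⟩
      exact Nat.lt_succ_of_le ht
    · intro hn
      exact ⟨⟨n, by omega⟩, Fin.mk_le_of_le_val (by omega), rfl⟩
  rw [← hmap, Finset.sum_map]
  exact Finset.sum_congr rfl fun t _ => getD_ofFn d t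

/-- **The stars-and-bars test** decides the bits of `sbCode d`. -/
theorem sbTest_ofFn (d : Fin g → ℕ) (j : ℕ) :
    sbTest g (List.ofFn d) j = true ↔
      ∃ i : Fin g, j = (i : ℕ) + ∑ t ∈ univ.filter (fun t : Fin g => t ≤ i), d t := by
  simp only [sbTest, List.any_eq_true, List.mem_range, decide_eq_true_eq]
  constructor
  · rintro ⟨i, hi, h⟩
    exact ⟨⟨i, hi⟩, by rw [h, psum_ofFn d ⟨i, hi⟩]⟩
  · rintro ⟨i, h⟩
    exact ⟨i, i.isLt, by rw [h, psum_ofFn d i]⟩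

/-- **The stars-and-bars number of `List.ofFn d` is the number of the code word `sbCode d`.** -/
theorem sbNum_ofFn (d : Fin g → ℕ) : sbNum g (List.ofFn d) = bv (sbCode d) := by
  rw [bv_eq_sum, sbNum, sum_map_range, ← Fin.sum_univ_eq_sum_range]
  refine Finset.sum_congr rfl fun j _ => ?_
  have hb : sbTest g (List.ofFn d) j = sbCode d j := by
    apply Bool.eq_iff_iff.2
    rw [sbTest_ofFn, sbCode, decide_eq_true_iff]
  rw [min_eq_left j.isLt.le, hb]
  cases sbCode d j <;> simp

/-! ### Admissibility and consistency -/

/-- The anchor exists iff the support is nonempty. -/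
theorem anchor_lt_iff (d : Fin g → ℕ) : anchor (List.ofFn d) < g ↔ (dsupp d).Nonempty := by
  have h := List.findIdx_lt_length (p := fun x => decide (0 < x)) (xs := List.ofFn d)
  rw [List.length_ofFn] at h
  rw [anchor, h]
  simp only [List.mem_ofFn, decide_eq_true_eq, dsupp, Finset.Nonempty, Finset.mem_filter, Finset.mem_univ,
    true_and]
  constructor
  · rintro ⟨x, ⟨i, rfl⟩, hx⟩; exact ⟨i, hx⟩
  · rintro ⟨i, hi⟩; exact ⟨d i, ⟨i, rfl⟩, hi⟩

/-- **The anchor is the least element of the support.** -/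
theorem anchor_eq_min' (d : Fin g → ℕ) (h : (dsupp d).Nonempty) (ha : anchor (List.ofFn d) < g) :
    (⟨anchor (List.ofFn d), ha⟩ : Fin g) = (dsupp d).min' h := by
  have hw : anchor (List.ofFn d) < (List.ofFn d).length := by simpa using ha
  have hmem : (⟨anchor (List.ofFn d), ha⟩ : Fin g) ∈ dsupp d := by
    have := List.findIdx_getElem (p := fun x => decide (0 < x)) (xs := List.ofFn d) (w := hw)
    simp only [List.getElem_ofFn, decide_eq_true_eq] at this
    exact Finset.mem_filter.2 ⟨Finset.mem_univ _, this⟩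
  refine le_antisymm (Finset.le_min' _ _ _ fun b hb => ?_) (Finset.min'_le _ _ hmem)
  by_contra hlt
  have hlt' : (b : ℕ) < (List.ofFn d).findIdx (fun x => decide (0 < x)) := by
    simp only [not_le, Fin.lt_def] at hlt; exact hlt
  have := List.not_of_lt_findIdx hlt'
  simp only [List.getElem_ofFn, Fin.eta, decide_eq_false_iff_not] at this
  exact this (by simpa [dsupp] using hb)

/-- **The admissibility test** decides `Adm`. -/
theorem admB_iff (d : Fin g → ℕ) (S : Fin g → Bool) : admB g (List.ofFn d) (bv S) = true ↔ Adm d S := by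
  simp only [admB, Adm, Bool.and_eq_true, List.all_eq_true, List.mem_range, Bool.or_eq_true, Bool.not_eq_true',
    decide_eq_false_iff_not, decide_eq_true_eq]
  refine and_congr ?_ ?_
  · rw [Fin.forall_iff]
    refine forall₂_congr fun i hi => ?_
    rw [bitsLE_eq_one_iff S hi, getD_ofFn d ⟨i, hi⟩]
    exact ⟨fun h hS => h.resolve_left (fun hn => hn hS),
      fun h => or_iff_not_imp_left.2 fun hn => h (not_not.1 hn)⟩
  · constructor
    · rintro ⟨ha, hb⟩
      have hne := (anchor_lt_iff d).1 ha
      refine ⟨hne, ?_⟩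
      rw [← anchor_eq_min' d hne ha, ← bitsLE_eq_one_iff S ha]
      exact hb
    · rintro ⟨hne, hS⟩
      have ha := (anchor_lt_iff d).2 hne
      refine ⟨ha, ?_⟩
      rw [bitsLE_eq_one_iff S ha, anchor_eq_min' d hne ha]
      exact hS

/-- **The consistency test** decides `consA`. -/
theorem consB_iff (PA : List (VSeq (Fin m) × (Fin g × Fin g))) (S : Fin g → Bool) :
    consB g (PA.map untypeQ) (bv S) = true ↔ consA PA S := by
  simp only [consB, consA, List.all_map, List.all_eq_true, Function.comp_apply]
  refine forall₂_congr fun q _ => ?_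
  rw [show (untypeQ q).2.1 = (q.2.1 : ℕ) from rfl, show (untypeQ q).2.2 = (q.2.2 : ℕ) from rfl,
    decide_bitsLE S q.2.1, decide_bitsLE S q.2.2, beq_iff_eq, Bool.eq_iff_iff]

/-- **The counted cuts** are those with a `1` in the F-block that are admissible and consistent. -/
theorem goodCut_iff (ab : AIdx m → Bool) (fb : FIdx m → Bool) (d : Fin (gOf m) → ℕ)
    (PA : List (VSeq (Fin m) × (Fin (gOf m) × Fin (gOf m)))) (S₀ S : Fin (gOf m) → Bool) :
    goodCut (encode m (Sum.elim ab fb)) m (gOf m) (List.ofFn d) (PA.map untypeQ) (bv S₀) (bv S) = true ↔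
      fb (sbCode d, S₀, S) = true ∧ Adm d S ∧ consA PA S := by
  rw [goodCut, sbNum_ofFn, fbit_encode, Bool.and_eq_true, Bool.and_eq_true, admB_iff, consB_iff]
  rfl

/-! ### The parity test -/

/-- Counting with `List.filter` over `List.range`, in `ZMod 2`. -/
theorem sum_boole_range (p : ℕ → Bool) :
    ∀ N : ℕ, ∑ n ∈ Finset.range N, (if p n then (1 : ZMod 2) else 0) =
      (((List.range N).filter p).length : ZMod 2)
  | 0 => by simp
  | N + 1 => by
    rw [Finset.sum_range_succ, sum_boole_range p N, List.range_succ, List.filter_append, List.length_append]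
    cases hp : p N <;> simp [hp]

/-- **The parity test decides the oddness of the pairing over `GF(2)`.** -/
theorem parityOK_iff {cap : ℕ} (hcap : 2 ^ gOf m ≤ cap) (ab : AIdx m → Bool) (fb : FIdx m → Bool)
    (d : Fin (gOf m) → ℕ) (PA : List (VSeq (Fin m) × (Fin (gOf m) × Fin (gOf m))))
    (S₀ : Fin (gOf m) → Bool) :
    parityOK (encode m (Sum.elim ab fb)) m (gOf m) cap (List.ofFn d) (PA.map untypeQ) (bv S₀) = true ↔
      ∑ S : Fin (gOf m) → Bool, (if fb (sbCode d, S₀, S) = true then (1 : ZMod 2) else 0) * vA d PA S = 1 := by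
  classical
  set s := encode m (Sum.elim ab fb) with hs
  set P : (Fin (gOf m) → Bool) → Prop := fun S => fb (sbCode d, S₀, S) = true ∧ Adm d S ∧ consA PA S with hP
  have hsummand : ∀ S, (if fb (sbCode d, S₀, S) = true then (1 : ZMod 2) else 0) * vA d PA S =
      if P S then 1 else 0 := by
    intro S
    unfold vA
    by_cases h1 : fb (sbCode d, S₀, S) = true <;> by_cases h2 : Adm d S ∧ consA PA S <;> simp [hP, h1, h2]
  have hgc : ∀ S, (if goodCut s m (gOf m) (List.ofFn d) (PA.map untypeQ) (bv S₀) (bv S) = true then (1 : ZMod 2)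
      else 0) = if P S then 1 else 0 := by
    intro S
    by_cases h : P S
    · rw [if_pos h, if_pos ((goodCut_iff ab fb d PA S₀ S).2 h)]
    · rw [if_neg h, if_neg (fun h' => h ((goodCut_iff ab fb d PA S₀ S).1 h'))]
  rw [Finset.sum_congr rfl (fun S _ => hsummand S)]
  have hequiv : ∑ S : Fin (gOf m) → Bool, (if P S then (1 : ZMod 2) else 0) =
      ∑ n ∈ Finset.range (2 ^ gOf m),
        if goodCut s m (gOf m) (List.ofFn d) (PA.map untypeQ) (bv S₀) n = true then (1 : ZMod 2) else 0 := by
    rw [← Fin.sum_univ_eq_sum_range]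
    exact Fintype.sum_equiv (boolVecEquiv (gOf m)) _ _ fun S => by rw [← hgc S]
  rw [hequiv, sum_boole_range, parityOK, min_eq_left hcap, decide_eq_true_iff, ZMod.natCast_eq_one_iff_odd,
    Nat.odd_iff]

/-! ### Arithmetic of the window -/

/-- `m ≤ ell m`. -/
theorem le_ell (m : ℕ) : m ≤ ell m := by
  unfold ell
  have : m ≤ m * m := Nat.le_mul_self m
  omega

/-- `m² ≤ ell m`. -/
theorem sq_le_ell (m : ℕ) : m * m ≤ ell m := by unfold ell; omega

/-- `gOf m ≤ m`. -/
theorem gOf_le (m : ℕ) : gOf m ≤ m := Nat.log_le_self 2 m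

/-- `2 ^ gOf m ≤ m` for `m ≠ 0`. -/
theorem two_pow_gOf_le {m : ℕ} (hm : m ≠ 0) : 2 ^ gOf m ≤ m := Nat.pow_log_le_self 2 hm

/-- `ellN m (gOf m) = ell m`. -/
theorem ellN_gOf (m : ℕ) : ellN m (gOf m) = ell m := rfl

/-! ### Soundness -/

/-- **Soundness of the verifier**: an accepted pair is an interface string of the residual language. -/
theorem check_sound (s : List Bool) (c : Cert) (h : check (s, c) = true) : s ∈ ResidueLang := by
  obtain ⟨m, dL, PAL, s0⟩ := c
  simp only [check, Bool.and_eq_true, decide_eq_true_eq] at h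
  obtain ⟨hm, h1⟩ := h
  have hg : min s.length (Nat.log 2 m) = gOf m := min_eq_right ((Nat.log_le_self 2 m).trans hm)
  rw [hg] at h1
  simp only [check₁, Bool.and_eq_true, decide_eq_true_eq] at h1
  obtain ⟨⟨⟨⟨⟨⟨⟨⟨hhdr, hd⟩, hshape⟩, hcover⟩, hchains⟩, hlabels⟩, hslots⟩, hs0⟩, hpar⟩ := h1
  simp only [hdrOK, Bool.and_eq_true, decide_eq_true_eq] at hhdr
  obtain ⟨h4, hlen⟩ := hhdr
  have hlen' : s.length = ell m := hlen
  set ab : AIdx m → Bool := fun a => vOf s m (Sum.inl a) with hab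
  set fb : FIdx m → Bool := fun f => vOf s m (Sum.inr f) with hfb
  have hsv : s = encode m (Sum.elim ab fb) := by rw [hab, hfb, sum_elim_vOf, encode_vOf hlen']
  have hdl : dL.length = gOf m := by
    simp only [dOK, Bool.and_eq_true, decide_eq_true_eq] at hd; exact hd.1
  obtain ⟨d, rfl⟩ := exists_eq_ofFn hdl
  obtain ⟨PA, rfl⟩ := exists_eq_map_untypeQ hshape
  obtain ⟨S₀, rfl⟩ := exists_eq_bv hs0
  have h2g : 2 ^ gOf m ≤ s.length := (two_pow_gOf_le (by omega)).trans hm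
  refine ⟨m, h4, ab, fb, hsv, d, (dOK_ofFn d).1 hd, PA, ⟨?_, ?_, ?_⟩, S₀, ?_⟩
  · refine (isCoverOf_iff hm ab fb PA).2 ⟨hcover, ?_⟩
    rw [← hsv]; exact hchains
  · refine (labelsOK_iff ab fb PA).1 ?_
    rw [← hsv]; exact hlabels
  · exact (slotsOK_iff d PA).1 hslots
  · refine (parityOK_iff h2g ab fb d PA S₀).1 ?_
    rw [← hsv]; exact hpar

/-! ### Completeness: short certificates -/

section Length

/-- Raw codes with bounded items. -/
theorem length_rawE_le {α : Type} (e : α → List Bool) {l : List α} {n B : ℕ} (hl : l.length ≤ n)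
    (hB : ∀ a ∈ l, (e a).length ≤ B) : (rawE e l).length ≤ n * (2 * B + 2) := by
  rw [length_rawE]
  calc (l.map fun a => 2 * (e a).length + 2).sum ≤ (l.map fun a => 2 * (e a).length + 2).length • (2 * B + 2) :=
        List.sum_le_card_nsmul _ _ fun x hx => by
          obtain ⟨a, ha, rfl⟩ := List.mem_map.1 hx
          have := hB a ha
          omega
    _ ≤ n * (2 * B + 2) := by rw [List.length_map, smul_eq_mul]; exact Nat.mul_le_mul_right _ hl

/-- Headed codes of lists of bounded numbers. -/
theorem length_listE_natE_le {l : List ℕ} {n B : ℕ} (hl : l.length ≤ n) (hB : ∀ a ∈ l, a ≤ B) :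
    (listE natE l).length ≤ 2 * n + 2 + n * (2 * B + 2) := by
  have h := length_rawE_le natE hl fun a ha => (length_natE_le a).trans (hB a ha)
  rw [listE, length_boolPair, length_unE]
  omega

/-- Codes of labelled paths with at most `m` vertices below `m` and labels `≤ m`. -/
theorem length_itemE_le {q : List ℕ × ℕ × ℕ} (hk : q.1.length ≤ m) (hv : ∀ v ∈ q.1, v ≤ m)
    (ha : q.2.1 ≤ m) (hb : q.2.2 ≤ m) : (itemE q).length ≤ 4 * m * m + 11 * m + 8 := by
  have h1 := length_listE_natE_le hk hv
  have h2 := (length_natE_le q.2.1).trans ha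
  have h3 := (length_natE_le q.2.2).trans hb
  rw [itemE, pairE_apply, length_boolPair, pairE_apply, length_boolPair]
  nlinarith

/-- A list of nonempty lists is at most as long as its flattening. -/
theorem length_le_length_flatten {α : Type} :
    ∀ {L : List (List α)}, (∀ l ∈ L, l ≠ []) → L.length ≤ L.flatten.length
  | [], _ => by simp
  | l :: L, h => by
    have hl : l ≠ [] := h l (by simp)
    have ih := length_le_length_flatten (L := L) fun l' hl' => h l' (by simp [hl'])
    have : 0 < l.length := List.length_pos_of_ne_nil hl
    rw [List.length_cons, List.flatten_cons, List.length_append]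
    omega

/-- **A path cover of the anchored block has at most `m` paths, each with at most `m` vertices.** -/
theorem sizes_of_isCoverOf {G : SimpleGraph (Fin m)} {S : Finset (Fin m)}
    {PA : List (VSeq (Fin m) × (Fin (gOf m) × Fin (gOf m)))} (h : IsCoverOf G S (PA.map Prod.fst)) :
    PA.length ≤ m ∧ ∀ q ∈ PA, q.1.verts.length ≤ m := by
  obtain ⟨hnd, -, -⟩ := h
  have hcard := hnd.length_le_card
  rw [Fintype.card_fin] at hcard
  refine ⟨?_, fun q hq => ?_⟩
  · have h1 := length_le_length_flatten (L := (PA.map Prod.fst).map VSeq.verts) fun l hl => by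
      obtain ⟨p, -, rfl⟩ := List.mem_map.1 hl
      exact List.cons_ne_nil _ _
    rw [List.length_map, List.length_map] at h1
    exact h1.trans hcard
  · have hq' : q.1.verts ∈ (PA.map Prod.fst).map VSeq.verts :=
      List.mem_map.2 ⟨q.1, List.mem_map.2 ⟨q, hq, rfl⟩, rfl⟩
    have hnd' := (List.nodup_flatten.1 hnd).1 _ hq'
    simpa using hnd'.length_le_card

/-- **The certificate of a witness is short**: `≤ 200 (ell m)² + 200`. -/
theorem length_certE_le (hm : 4 ≤ m) {d : Fin (gOf m) → ℕ} (hd : ∑ t, d t ≤ 2 * gOf m)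
    {PA : List (VSeq (Fin m) × (Fin (gOf m) × Fin (gOf m)))} (hlen : PA.length ≤ m)
    (hverts : ∀ q ∈ PA, q.1.verts.length ≤ m) (S₀ : Fin (gOf m) → Bool) :
    (certE (m, List.ofFn d, PA.map untypeQ, bv S₀)).length ≤ 200 * (ell m) ^ 2 + 200 := by
  have hg := gOf_le m
  have h2g : 2 ^ gOf m ≤ m := two_pow_gOf_le (by omega)
  -- the four fields
  have hA : (natE m).length ≤ m := length_natE_le m
  have hB : (listE natE (List.ofFn d)).length ≤ 2 * m + 2 + m * (2 * (2 * m) + 2) := by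
    refine length_listE_natE_le (by simp [hg]) fun a ha => ?_
    obtain ⟨i, rfl⟩ := List.mem_ofFn.1 ha
    have : d i ≤ ∑ t, d t := Finset.single_le_sum (fun t _ => Nat.zero_le (d t)) (Finset.mem_univ i)
    omega
  have hC : (listE itemE (PA.map untypeQ)).length ≤ 2 * m + 2 + m * (2 * (4 * m * m + 11 * m + 8) + 2) := by
    rw [listE, length_boolPair, length_unE, List.length_map]
    have h := length_rawE_le itemE (l := PA.map untypeQ) (n := m) (B := 4 * m * m + 11 * m + 8)
      (by rw [List.length_map]; exact hlen) fun q hq => by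
        obtain ⟨q', hq', rfl⟩ := List.mem_map.1 hq
        refine length_itemE_le ?_ ?_ ?_ ?_
        · simpa [untypeQ] using hverts q' hq'
        · intro v hv
          obtain ⟨w, -, rfl⟩ := List.mem_map.1 hv
          exact w.isLt.le
        · exact (q'.2.1.isLt.le).trans hg
        · exact (q'.2.2.isLt.le).trans hg
    omega
  have hD : (natE (bv S₀)).length ≤ m := (length_natE_le _).trans ((bv_lt S₀).le.trans h2g)
  have htot : (certE (m, List.ofFn d, PA.map untypeQ, bv S₀)).length ≤
      16 * m * m * m + 52 * m * m + 91 * m + 14 := by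
    rw [certE, pairE_apply, length_boolPair, pairE_apply, length_boolPair, pairE_apply, length_boolPair]
    simp only
    nlinarith
  have h1 := le_ell m
  have h2 := sq_le_ell m
  have h3 : m * m * m ≤ ell m * ell m := by nlinarith
  nlinarith

end Length

/-- **Completeness of the verifier**: every interface string of the residual language has a short
accepted certificate — the untyped form `(m, List.ofFn d, PA.map untypeQ, bv S₀)` of a witness. -/
theorem check_complete {m : ℕ} (hm : 4 ≤ m) (ab : AIdx m → Bool) (fb : FIdx m → Bool) (hR : Residue m ab fb) :
    ∃ c : Cert,
      (certE c).length ≤ (C 200 * X ^ 2 + C 200 : Polynomial ℕ).eval (encode m (Sum.elim ab fb)).length ∧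
        check (encode m (Sum.elim ab fb), c) = true := by
  obtain ⟨d, hd, PA, ⟨hcov, hlab, hslot⟩, S₀, hpar⟩ := hR
  obtain ⟨hlenPA, hverts⟩ := sizes_of_isCoverOf hcov
  refine ⟨(m, List.ofFn d, PA.map untypeQ, bv S₀), ?_, ?_⟩
  · rw [length_encode']
    simpa using length_certE_le hm hd hlenPA hverts S₀
  · set s := encode m (Sum.elim ab fb) with hs
    have hlen : s.length = ell m := length_encode' _
    have hms : m ≤ s.length := hlen ▸ le_ell m
    have hg : min s.length (Nat.log 2 m) = gOf m := min_eq_right ((Nat.log_le_self 2 m).trans hms)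
    have h2g : 2 ^ gOf m ≤ s.length := (two_pow_gOf_le (by omega)).trans hms
    have hcov' := (isCoverOf_iff hms ab fb PA).1 hcov
    simp only [check, Bool.and_eq_true, decide_eq_true_eq]
    refine ⟨hms, ?_⟩
    rw [hg]
    simp only [check₁, Bool.and_eq_true, decide_eq_true_eq]
    refine ⟨⟨⟨⟨⟨⟨⟨⟨?_, (dOK_ofFn d).2 hd⟩, shapeOK_map_untypeQ PA⟩, hcov'.1⟩, hcov'.2⟩,
      (labelsOK_iff ab fb PA).2 hlab⟩, (slotsOK_iff d PA).2 hslot⟩, bv_lt S₀⟩,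
      (parityOK_iff h2g ab fb d PA S₀).2 hpar⟩
    simp only [hdrOK, Bool.and_eq_true, decide_eq_true_eq]
    exact ⟨hm, hlen⟩

end ResNP

/-- **stub_residueNP** (line `kotzig-cutspan` of crux `SymmetryBudget.HamCompiles`): the residual
language is in `NP = polyExists P`. The `P`-language is `{⟨s, y⟩ | ResNP.check (s, decCert y)}`
(`ResNP.check_code`: the verifier is an `FP` string function built from the tree's bricks; no
machine is written), certificates are the codes of `(m, d, PA, s₀)` of length `≤ 200|s|² + 200`,
and `ResNP.check_sound` / `ResNP.check_complete` identify the accepted strings with `ResidueLang`. -/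
theorem stub_residueNP : ResidueLang ∈ Nondeterministic.NP :=
  ResNP.mem_NP_of_check ResNP.check_code (C 200 * X ^ 2 + C 200) ResNP.check_sound fun s hs => by
    obtain ⟨m, hm, ab, fb, rfl, hR⟩ := hs
    exact ResNP.check_complete hm ab fb hR

end Summit.PneNP.PneNP.Theorems.HamCompilesKC
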